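import Summits.AtomisticToContinuum.HydrodynamicLimit.Theorems.TwoClocksTransferEntropyClockCoherence
import Summits.AtomisticToContinuum.HydrodynamicLimit.Theorems.OneFlightGossipEngineClampedCurrentsDockCubicChannelPrelim
import HarnessLib

/-!
# The occupation form of the coherence input `CoherentSuprathermalContentVanishesW`, and CSCV-W ⇒ occupation form
# (support file, `--supports stmt-AtomisticToContinuum-17372`, line `IdeatorOneSketch`, conjunct CSCV-W of `stub_inputs`)

Crux `ImplosionDichotomy.HydroLimitProfilewiseBand` (stmt-AtomisticToContinuum-17372), line `IdeatorOneSketch`, registered stub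
`stub_inputs : LineInputs` whose third conjunct is the un-itemed true-law input
`HydroLimitInBandOfHeart.CoherentSuprathermalContentVanishesW` (CSCV-W; shared verbatim with stmt-9133's line and the sibling
crux 14680's S6′). CSCV-W tests, under the TRUE pre-shock law over one kinetic window `[s, s+w]`, the mean over particles of
`1{η·cub_i < ‖qbar_i‖} · cubHi_i`, where `cubHi_i = w⁻¹ ∫ 1{K⋆ < ‖W_i‖} ‖W_i‖³` is the window-averaged SUPRATHERMAL CUBE of the
peculiar velocity `W_i = v_i − u_s(x_i)`. This file and its companion `…CoherenceOccupationECT.lean` remove the cube: MODULO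
`EnergyCurrentTails` (ECT, board item stmt-9235, itself a conjunct of the same stub) CSCV-W IS EQUIVALENT TO ITS OCCUPATION FORM.

* §0 `CoherentSuprathermalOccupationVanishes` (CSOV) — verbatim CSCV-W with `cubHi_i` replaced by the suprathermal OCCUPATION
  FRACTION `occ_i = w⁻¹ ∫ 1{K⋆ < ‖W_i‖} ∈ [0, 1]` of the window: no velocity moment left in the tested quantity.
* §1 pointwise: the level split `1{K<‖W‖}‖W‖³ ≤ L³·1{K<‖W‖} + 1{L<‖W‖}‖W‖³` (`K ≤ L`), `1{K<‖W‖} ≤ K⁻³·1{K<‖W‖}‖W‖³`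
  (`K > 0`), and the peculiar-versus-absolute tail `1{L<‖W‖}‖W‖³ ≤ 8·1{M<‖v‖}‖v‖³` when `‖v − W‖ ≤ U ≤ M`, `2M ≤ L`.
* §2 on a window, for measurable signals with integrable cubes: `occ ≤ K⁻³ cubHi` and `cubHi ≤ L³ occ + 8 w⁻¹∫1{M<‖v‖}‖v‖³`.
* §3 along good hard-sphere orbits, summed over particles with arbitrary coherence thresholds (`sum_cohHi_le`).
* §4 `occupation_of_coherentW : CSCV-W → CSOV` (registered support signature): same `σ₀, K⋆, τ₀, N₀`, accuracy `ε K⋆³`,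
  pathwise `occ ≤ K⋆⁻³ cubHi` on the good set, which carries `localGibbsLaw`.

The converse `EnergyCurrentTails → CSOV → CSCV-W` (level split + ECT's tails by Tonelli) is the companion file. So what is open in
CSCV-W, given ECT, is exactly the rarity — in window occupation measure — of direction-coherent suprathermal excursions under the
true law: the form a disprover or a future owner of the SPLIT-REQUEST child (ii) should attack.
Lead `prover-line-stmt-AtomisticToContinuum-17372-c5-0` (line cycle 6).
-/

noncomputable section

open MeasureTheory Filter Set Topology
open scoped ENNReal

namespace Summit.AtomisticToContinuum.HydrodynamicLimit.Theorems.HydroLimitBandCoherenceOccupation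

open Literature.MathematicalPhysics.KineticTheory Literature.Analysis.FluidPDE Literature.Analysis.FunctionSpaces
open Summit.AtomisticToContinuum.HydrodynamicLimit.Theses
open Summit.AtomisticToContinuum.HydrodynamicLimit.Theorems.HydroLimitInBandOfHeart (CoherentSuprathermalContentVanishesW)
open Summit.AtomisticToContinuum.HydrodynamicLimit.Theorems.TransferEntropyClockCoherence
open Summit.AtomisticToContinuum.HydrodynamicLimit.Theorems.ClampedCurrentsDockCubicChannelPrelim

/-! ## §0 The occupation form of the coherence input -/

/-- **`CoherentSuprathermalOccupationVanishes` (CSOV) — the OCCUPATION form of the weighted coherence input.** Verbatim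
`HydroLimitInBandOfHeart.CoherentSuprathermalContentVanishesW` except that the coherent particles are weighted by the
window OCCUPATION FRACTION `occ_i = w⁻¹ ∫_s^{s+w} 1{K⋆ < ‖W_i‖} dr ∈ [0,1]` of their suprathermal excursions instead of the
suprathermal cube `cubHi_i = w⁻¹ ∫ 1{K⋆ < ‖W_i‖}‖W_i‖³`: for continuous positive profiles, small `σ`, every tied classical
solution, every flow family and `t < T` there is `K⋆ > 0` such that for every admissible radial weight `R`, every
`η, ε > 0`, over long kinetic windows and for `N` large, the true-law mean over particles of
`1{η·cub_i < ‖qbar_i‖} · occ_i` is at most `ε`. Route-internal reformulation (equivalent to CSCV-W given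
`EnergyCurrentTails`, `coherentW_iff_occupation`), not a cited fact. -/
def CoherentSuprathermalOccupationVanishes : Prop :=
  ∀ (a₀ θ₀ : T3 → ℝ) (u₀ : T3 → V3), Continuous a₀ → Continuous θ₀ → Continuous u₀ →
    (∀ x, 0 < a₀ x) → (∀ x, 0 < θ₀ x) →
    ∃ σ₀ : ℝ, 0 < σ₀ ∧ ∀ σ : ℝ, 0 < σ → σ < σ₀ →
    ∀ (T : ℝ) (ρ θ : ℝ → T3 → ℝ) (u : ℝ → T3 → V3), IsHardSphereEulerSolution σ T ρ u θ →
    ∀ Φ : (N : ℕ) → HardSphereFlow (Torus.geometry (Fin 3)) (hsDiameter σ N) (N + 1),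
    TendstoHydroFieldsAt (fun N => localGibbsLaw σ a₀ u₀ θ₀ N (Φ N)) Φ ρ u θ 0 →
    ∀ t ∈ Set.Ico 0 T, ∃ Kstar : ℝ, 0 < Kstar ∧
    ∀ R : ℝ → T3 → ℝ → ℝ, Measurable (fun p : ℝ × T3 × ℝ => R p.1 p.2.1 p.2.2) →
    (∀ s x s', s' ≤ Kstar ^ 2 → R s x s' = 0) → (∀ s x s', |R s x s'| ≤ |s'|) →
    ∀ η : ℝ, 0 < η → ∀ ε : ℝ, 0 < ε →
    ∃ τ₀ : ℝ, 0 < τ₀ ∧ ∀ τ : ℝ, τ₀ ≤ τ → ∃ N₀ : ℕ, ∀ N : ℕ, N₀ ≤ N → ∀ s ∈ Set.Icc 0 t,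
      (let w : ℝ := τ * ((N : ℝ) + 1) ^ (-(1 / 3 : ℝ))
       let P := localGibbsLaw σ a₀ u₀ θ₀ N (Φ N)
       let W := fun (i : Fin (N + 1)) (s r : ℝ) (z : Config (N + 1) (Fin 3) T3) =>
         ((Φ N).flow r z i).2 - u s ((Φ N).flow r z i).1
       let cub := fun (i : Fin (N + 1)) (s : ℝ) (z : Config (N + 1) (Fin 3) T3) =>
         w⁻¹ * ∫ r in s..(s + w), ‖W i s r z‖ ^ 3
       let occ := fun (i : Fin (N + 1)) (s : ℝ) (z : Config (N + 1) (Fin 3) T3) =>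
         w⁻¹ * ∫ r in s..(s + w), (if Kstar < ‖W i s r z‖ then (1 : ℝ) else 0)
       let qbar := fun (i : Fin (N + 1)) (s : ℝ) (z : Config (N + 1) (Fin 3) T3) =>
         w⁻¹ • ∫ r in s..(s + w), (R s ((Φ N).flow r z i).1 (‖W i s r z‖ ^ 2)) • W i s r z
       ∫⁻ z, ENNReal.ofReal (((N : ℝ) + 1)⁻¹ * ∑ i : Fin (N + 1),
              (if η * cub i s z < ‖qbar i s z‖ then occ i s z else 0)) ∂P ≤ ENNReal.ofReal ε)

/-! ## §1 Pointwise: level split of the suprathermal cube, occupation versus cube, peculiar versus absolute tails -/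

/-- The suprathermal indicator `1{K < ‖v‖}` is nonnegative. [folklore] -/
theorem ite_one_nonneg (K : ℝ) (v : V3) : 0 ≤ (if K < ‖v‖ then (1 : ℝ) else 0) := by
  split_ifs <;> norm_num

/-- The suprathermal indicator is at most `1`. [folklore] -/
theorem ite_one_le_one (K : ℝ) (v : V3) : (if K < ‖v‖ then (1 : ℝ) else 0) ≤ 1 := by
  split_ifs <;> norm_num

/-- **Level split of the suprathermal cube**: for `K ≤ L`, `0 ≤ L`,
`1{K < ‖v‖}‖v‖³ ≤ L³·1{K < ‖v‖} + 1{L < ‖v‖}‖v‖³`. [folklore] -/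
theorem hiCube_le_levelSplit {K L : ℝ} (hKL : K ≤ L) (hL : 0 ≤ L) (v : V3) :
    (if K < ‖v‖ then ‖v‖ ^ 3 else (0 : ℝ)) ≤
      L ^ 3 * (if K < ‖v‖ then (1 : ℝ) else 0) + (if L < ‖v‖ then ‖v‖ ^ 3 else (0 : ℝ)) := by
  by_cases hK : K < ‖v‖
  · rw [if_pos hK, if_pos hK, mul_one]
    by_cases hLv : L < ‖v‖
    · rw [if_pos hLv]
      linarith [pow_nonneg hL 3]
    · rw [if_neg hLv, add_zero]
      exact pow_le_pow_left₀ (norm_nonneg _) (not_lt.1 hLv) 3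
  · have hLv : ¬ L < ‖v‖ := fun h => hK (hKL.trans_lt h)
    rw [if_neg hK, if_neg hK, if_neg hLv, mul_zero, add_zero]

/-- **Occupation versus cube**: for `0 < K`, `1{K < ‖v‖} ≤ K⁻³ · 1{K < ‖v‖}‖v‖³`. [folklore] -/
theorem ite_one_le_inv_mul_hiCube {K : ℝ} (hK : 0 < K) (v : V3) :
    (if K < ‖v‖ then (1 : ℝ) else 0) ≤ (K ^ 3)⁻¹ * (if K < ‖v‖ then ‖v‖ ^ 3 else (0 : ℝ)) := by
  by_cases h : K < ‖v‖
  · rw [if_pos h, if_pos h, ← div_eq_inv_mul, le_div_iff₀ (pow_pos hK 3), one_mul]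
    exact pow_le_pow_left₀ hK.le h.le 3
  · rw [if_neg h, if_neg h, mul_zero]

/-- **Peculiar versus absolute tails**: if `‖v − W‖ ≤ U ≤ M` and `2M ≤ L`, then
`1{L < ‖W‖}‖W‖³ ≤ 8 · 1{M < ‖v‖}‖v‖³` (on the event `‖v‖ ≥ ‖W‖ − U > M` and `‖W‖ ≤ 2‖v‖`). Used with `W = v − u_s(x)`,
`U = sup ‖u_s‖`. [folklore] -/
theorem hiCube_le_tail {L M U : ℝ} (hUM : U ≤ M) (hML : 2 * M ≤ L) (v W : V3) (hvW : ‖v - W‖ ≤ U) :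
    (if L < ‖W‖ then ‖W‖ ^ 3 else (0 : ℝ)) ≤ 8 * Set.indicator {v : V3 | M < ‖v‖} (fun v => ‖v‖ ^ 3) v := by
  by_cases h : L < ‖W‖
  · rw [if_pos h]
    have h1 : ‖W‖ ≤ ‖v‖ + U := by
      calc ‖W‖ = ‖v - (v - W)‖ := by rw [sub_sub_cancel]
        _ ≤ ‖v‖ + ‖v - W‖ := norm_sub_le _ _
        _ ≤ ‖v‖ + U := add_le_add le_rfl hvW
    have hMv : M < ‖v‖ := by linarith
    rw [Set.indicator_of_mem (show v ∈ {v : V3 | M < ‖v‖} from hMv)]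
    have h2 : ‖W‖ ≤ 2 * ‖v‖ := by linarith
    calc ‖W‖ ^ 3 ≤ (2 * ‖v‖) ^ 3 := pow_le_pow_left₀ (norm_nonneg _) h2 3
      _ = 8 * ‖v‖ ^ 3 := by ring
  · rw [if_neg h]
    exact mul_nonneg (by norm_num) (Set.indicator_nonneg (fun v _ => by positivity) _)

/-! ## §2 On a window: `occ ≤ K⁻³ cubHi` and `cubHi ≤ L³ occ + 8 · (tail window)` for measurable signals with integrable cubes -/

/-- The suprathermal indicator of a measurable signal is interval integrable (bounded by `1`). [folklore] -/
theorem intervalIntegrable_one {K s w : ℝ} {W : ℝ → V3} (hWm : Measurable W) :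
    IntervalIntegrable (fun r => if K < ‖W r‖ then (1 : ℝ) else 0) volume s (s + w) := by
  refine (intervalIntegrable_const (c := (1 : ℝ))).mono_fun' ?_ (ae_of_all _ fun r => ?_)
  · exact (Measurable.ite (measurableSet_lt measurable_const hWm.norm) measurable_const
      measurable_const).aestronglyMeasurable
  · dsimp only
    rw [Real.norm_eq_abs, abs_of_nonneg (ite_one_nonneg K (W r))]
    exact ite_one_le_one K (W r)

/-- The cubic velocity tail of a measurable signal with integrable cube is interval integrable. [folklore] -/
theorem intervalIntegrable_tail {M s w : ℝ} {v : ℝ → V3} (hvm : Measurable v)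
    (hv3 : IntervalIntegrable (fun r => ‖v r‖ ^ 3) volume s (s + w)) :
    IntervalIntegrable (fun r => Set.indicator {v : V3 | M < ‖v‖} (fun v => ‖v‖ ^ 3) (v r)) volume s (s + w) := by
  refine hv3.mono_fun' ?_ (ae_of_all _ fun r => ?_)
  · exact (((measurable_norm.pow_const 3).indicator (measurableSet_lt measurable_const measurable_norm)).comp
      hvm).aestronglyMeasurable
  · dsimp only
    rw [Real.norm_eq_abs, abs_of_nonneg (Set.indicator_nonneg (fun v _ => by positivity) _)]
    exact Set.indicator_le_self' (fun v _ => by positivity) _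

/-- **`occ ≤ K⁻³ cubHi` on a window** (`w ≥ 0`, `K > 0`, measurable signal with integrable cube). [folklore] -/
theorem windowAvg_one_le_inv_mul_hi {K s w : ℝ} (hK : 0 < K) (hw : 0 ≤ w) {W : ℝ → V3} (hWm : Measurable W)
    (hW3 : IntervalIntegrable (fun r => ‖W r‖ ^ 3) volume s (s + w)) :
    w⁻¹ * ∫ r in s..(s + w), (if K < ‖W r‖ then (1 : ℝ) else 0) ≤
      (K ^ 3)⁻¹ * (w⁻¹ * ∫ r in s..(s + w), (if K < ‖W r‖ then ‖W r‖ ^ 3 else (0 : ℝ))) := by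
  have hsw : s ≤ s + w := le_add_of_nonneg_right hw
  have hmono := intervalIntegral.integral_mono_on hsw (intervalIntegrable_one hWm)
    ((intervalIntegrable_hi hWm hW3).const_mul ((K ^ 3)⁻¹)) fun r _ => ite_one_le_inv_mul_hiCube hK (W r)
  rw [intervalIntegral.integral_const_mul] at hmono
  calc w⁻¹ * ∫ r in s..(s + w), (if K < ‖W r‖ then (1 : ℝ) else 0)
      ≤ w⁻¹ * ((K ^ 3)⁻¹ * ∫ r in s..(s + w), (if K < ‖W r‖ then ‖W r‖ ^ 3 else (0 : ℝ))) :=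
        mul_le_mul_of_nonneg_left hmono (inv_nonneg.2 hw)
    _ = _ := by ring

/-- **`cubHi ≤ L³ occ + 8 · (tail window)` on a window.** For `w ≥ 0`, levels `K ≤ L`, `0 ≤ L`, `U ≤ M`, `2M ≤ L`, a
measurable peculiar signal `W` and a measurable velocity signal `v` with integrable cubes and `‖v − W‖ ≤ U` pointwise:
`w⁻¹∫1{K<‖W‖}‖W‖³ ≤ L³ · w⁻¹∫1{K<‖W‖} + 8 · w⁻¹∫1{M<‖v‖}‖v‖³`. [folklore] -/
theorem windowAvg_hi_le_split {K L M U s w : ℝ} (hKL : K ≤ L) (hL : 0 ≤ L) (hUM : U ≤ M) (hML : 2 * M ≤ L)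
    (hw : 0 ≤ w) {W v : ℝ → V3} (hWm : Measurable W) (hvm : Measurable v)
    (hW3 : IntervalIntegrable (fun r => ‖W r‖ ^ 3) volume s (s + w))
    (hv3 : IntervalIntegrable (fun r => ‖v r‖ ^ 3) volume s (s + w)) (hvW : ∀ r, ‖v r - W r‖ ≤ U) :
    w⁻¹ * ∫ r in s..(s + w), (if K < ‖W r‖ then ‖W r‖ ^ 3 else (0 : ℝ)) ≤
      L ^ 3 * (w⁻¹ * ∫ r in s..(s + w), (if K < ‖W r‖ then (1 : ℝ) else 0)) +
        8 * (w⁻¹ * ∫ r in s..(s + w), Set.indicator {v : V3 | M < ‖v‖} (fun v => ‖v‖ ^ 3) (v r)) := by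
  have hsw : s ≤ s + w := le_add_of_nonneg_right hw
  have hIone := intervalIntegrable_one (K := K) (s := s) (w := w) hWm
  have hItail := intervalIntegrable_tail (M := M) hvm hv3
  have hpt : ∀ r ∈ Icc s (s + w), (if K < ‖W r‖ then ‖W r‖ ^ 3 else (0 : ℝ)) ≤
      L ^ 3 * (if K < ‖W r‖ then (1 : ℝ) else 0) +
        8 * Set.indicator {v : V3 | M < ‖v‖} (fun v => ‖v‖ ^ 3) (v r) := fun r _ =>
    (hiCube_le_levelSplit hKL hL (W r)).trans (add_le_add le_rfl (hiCube_le_tail hUM hML (v r) (W r) (hvW r)))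
  have hmono := intervalIntegral.integral_mono_on hsw (intervalIntegrable_hi hWm hW3)
    ((hIone.const_mul (L ^ 3)).add (hItail.const_mul 8)) hpt
  rw [intervalIntegral.integral_add (hIone.const_mul _) (hItail.const_mul _), intervalIntegral.integral_const_mul,
    intervalIntegral.integral_const_mul] at hmono
  calc w⁻¹ * ∫ r in s..(s + w), (if K < ‖W r‖ then ‖W r‖ ^ 3 else (0 : ℝ))
      ≤ w⁻¹ * (L ^ 3 * (∫ r in s..(s + w), (if K < ‖W r‖ then (1 : ℝ) else 0)) +
          8 * ∫ r in s..(s + w), Set.indicator {v : V3 | M < ‖v‖} (fun v => ‖v‖ ^ 3) (v r)) :=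
        mul_le_mul_of_nonneg_left hmono (inv_nonneg.2 hw)
    _ = _ := by ring

/-- The coherence summand inherits a bound `A ≤ c·B + T` with `T ≥ 0`: `1{p}A ≤ c·1{p}B + T`. [folklore] -/
theorem ite_le_of_le {p : Prop} [Decidable p] {A B T c : ℝ} (h : A ≤ c * B + T) (hT : 0 ≤ T) :
    (if p then A else 0) ≤ c * (if p then B else 0) + T := by
  split_ifs
  · exact h
  · rw [mul_zero, zero_add]; exact hT

/-! ## §3 Along good hard-sphere orbits, summed over particles -/

variable {σ : ℝ} {N : ℕ}

/-- The cube of the speed of a particle along a good orbit is interval integrable (energy conservation). [folklore] -/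
theorem intervalIntegrable_norm_vel_pow_three (Φ : HardSphereFlow (Torus.geometry (Fin 3)) (hsDiameter σ N) (N + 1))
    {z : Config (N + 1) (Fin 3) T3} (hz : z ∈ Φ.good) (i : Fin (N + 1)) (a b : ℝ) :
    IntervalIntegrable (fun r => ‖(Φ.flow r z i).2‖ ^ 3) volume a b := by
  have h := intervalIntegrable_norm_peculiar_pow Φ hz (uu := fun _ => (0 : V3)) continuous_const i 3 a b
  simpa only [sub_zero] using h

/-- `1{p}A ≤ k·1{p}B` from `A ≤ k·B`. [folklore] -/
theorem ite_le_mul_ite {p : Prop} [Decidable p] {A B k : ℝ} (h : A ≤ k * B) :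
    (if p then A else 0) ≤ k * (if p then B else 0) := by
  split_ifs
  · exact h
  · rw [mul_zero]

/-- Averaged form: `a Σ_i 1{c_i<q_i} A_i ≤ k · a Σ_i 1{c_i<q_i} B_i` from `A_i ≤ k B_i` and `a ≥ 0`. [folklore] -/
theorem avg_ite_le_const_mul {n : ℕ} {c q A B : Fin n → ℝ} {k a : ℝ} (ha : 0 ≤ a) (h : ∀ i, A i ≤ k * B i) :
    a * ∑ i, (if c i < q i then A i else 0) ≤ k * (a * ∑ i, (if c i < q i then B i else 0)) := by
  calc a * ∑ i, (if c i < q i then A i else 0) ≤ a * ∑ i, k * (if c i < q i then B i else 0) :=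
        mul_le_mul_of_nonneg_left (Finset.sum_le_sum fun i _ => ite_le_mul_ite (h i)) ha
    _ = k * (a * ∑ i, (if c i < q i then B i else 0)) := by rw [← Finset.mul_sum]; ring

/-- **Pathwise, summed over particles (good orbit).** With a continuous field `uu`, `‖uu‖ ≤ U ≤ M`, `2M ≤ L`, `K ≤ L`,
`0 ≤ L`, `w ≥ 0` and any coherence thresholds `c_i < q_i`:
`Σ_i 1{c_i<q_i} cubHi_i ≤ L³ Σ_i 1{c_i<q_i} occ_i + 8 w⁻¹ ∫_s^{s+w} Σ_i 1{M<‖v_i(r)‖}‖v_i(r)‖³ dr`. [folklore] -/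
theorem sum_cohHi_le (Φ : HardSphereFlow (Torus.geometry (Fin 3)) (hsDiameter σ N) (N + 1))
    {z : Config (N + 1) (Fin 3) T3} (hz : z ∈ Φ.good) {uu : T3 → V3} (huc : Continuous uu)
    {U M L K s w : ℝ} (hule : ∀ x, ‖uu x‖ ≤ U) (hUM : U ≤ M) (hML : 2 * M ≤ L) (hKL : K ≤ L) (hL : 0 ≤ L)
    (hw : 0 ≤ w) (c q : Fin (N + 1) → ℝ) :
    ∑ i : Fin (N + 1), (if c i < q i then
        w⁻¹ * ∫ r in s..(s + w), (if K < ‖(Φ.flow r z i).2 - uu (Φ.flow r z i).1‖ then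
          ‖(Φ.flow r z i).2 - uu (Φ.flow r z i).1‖ ^ 3 else (0 : ℝ)) else 0) ≤
      L ^ 3 * ∑ i : Fin (N + 1), (if c i < q i then
        w⁻¹ * ∫ r in s..(s + w), (if K < ‖(Φ.flow r z i).2 - uu (Φ.flow r z i).1‖ then (1 : ℝ) else 0) else 0) +
      8 * w⁻¹ * ∫ r in s..(s + w), ∑ i : Fin (N + 1),
        Set.indicator {v : V3 | M < ‖v‖} (fun v => ‖v‖ ^ 3) ((Φ.flow r z i).2) := by
  have hT : ∀ i : Fin (N + 1), IntervalIntegrable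
      (fun r => Set.indicator {v : V3 | M < ‖v‖} (fun v => ‖v‖ ^ 3) ((Φ.flow r z i).2)) volume s (s + w) := fun i =>
    intervalIntegrable_tail (Φ.measurable_vel_orbit hz i) (intervalIntegrable_norm_vel_pow_three Φ hz i s (s + w))
  have hsum : ∫ r in s..(s + w), ∑ i : Fin (N + 1), Set.indicator {v : V3 | M < ‖v‖} (fun v => ‖v‖ ^ 3) ((Φ.flow r z i).2) =
      ∑ i : Fin (N + 1), ∫ r in s..(s + w), Set.indicator {v : V3 | M < ‖v‖} (fun v => ‖v‖ ^ 3) ((Φ.flow r z i).2) :=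
    intervalIntegral.integral_finsetSum fun i _ => hT i
  have hper : ∀ i : Fin (N + 1), (if c i < q i then
      w⁻¹ * ∫ r in s..(s + w), (if K < ‖(Φ.flow r z i).2 - uu (Φ.flow r z i).1‖ then
        ‖(Φ.flow r z i).2 - uu (Φ.flow r z i).1‖ ^ 3 else (0 : ℝ)) else 0) ≤
      L ^ 3 * (if c i < q i then
        w⁻¹ * ∫ r in s..(s + w), (if K < ‖(Φ.flow r z i).2 - uu (Φ.flow r z i).1‖ then (1 : ℝ) else 0) else 0) +
      8 * (w⁻¹ * ∫ r in s..(s + w), Set.indicator {v : V3 | M < ‖v‖} (fun v => ‖v‖ ^ 3) ((Φ.flow r z i).2)) := by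
    intro i
    refine ite_le_of_le ?_ (mul_nonneg (by norm_num) (mul_nonneg (inv_nonneg.2 hw)
      (intervalIntegral.integral_nonneg (le_add_of_nonneg_right hw) fun r _ =>
        Set.indicator_nonneg (fun v _ => by positivity) _)))
    exact windowAvg_hi_le_split hKL hL hUM hML hw (measurable_peculiar_orbit Φ hz huc i) (Φ.measurable_vel_orbit hz i)
      (intervalIntegrable_norm_peculiar_pow Φ hz huc i 3 s (s + w)) (intervalIntegrable_norm_vel_pow_three Φ hz i s (s + w))
      (fun r => by rw [sub_sub_cancel]; exact hule _)
  calc _ ≤ ∑ i : Fin (N + 1), (L ^ 3 * (if c i < q i then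
        w⁻¹ * ∫ r in s..(s + w), (if K < ‖(Φ.flow r z i).2 - uu (Φ.flow r z i).1‖ then (1 : ℝ) else 0) else 0) +
      8 * (w⁻¹ * ∫ r in s..(s + w), Set.indicator {v : V3 | M < ‖v‖} (fun v => ‖v‖ ^ 3) ((Φ.flow r z i).2))) :=
        Finset.sum_le_sum fun i _ => hper i
    _ = _ := by
        rw [Finset.sum_add_distrib, ← Finset.mul_sum, ← Finset.mul_sum, ← Finset.mul_sum, hsum, mul_assoc]

/-! ## §4 CSCV-W ⇒ CSOV -/

/-- If a.e. `f ≤ c·g` with `c ≥ 0` and `E[ofReal g] ≤ ofReal B`, then `E[ofReal f] ≤ ofReal (c·B)`. [folklore] -/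
theorem lintegral_ofReal_le_of_ae_le_const_mul {α : Type*} [MeasurableSpace α] {P : Measure α} {f g : α → ℝ}
    {c B : ℝ} (hc : 0 ≤ c) (h : ∀ᵐ z ∂P, f z ≤ c * g z) (hg : ∫⁻ z, ENNReal.ofReal (g z) ∂P ≤ ENNReal.ofReal B) :
    ∫⁻ z, ENNReal.ofReal (f z) ∂P ≤ ENNReal.ofReal (c * B) := by
  calc ∫⁻ z, ENNReal.ofReal (f z) ∂P ≤ ∫⁻ z, ENNReal.ofReal c * ENNReal.ofReal (g z) ∂P := by
        refine lintegral_mono_ae ?_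
        filter_upwards [h] with z hz
        rw [← ENNReal.ofReal_mul hc]
        exact ENNReal.ofReal_le_ofReal hz
    _ = ENNReal.ofReal c * ∫⁻ z, ENNReal.ofReal (g z) ∂P := lintegral_const_mul' _ _ ENNReal.ofReal_ne_top
    _ ≤ ENNReal.ofReal c * ENNReal.ofReal B := by gcongr
    _ = ENNReal.ofReal (c * B) := (ENNReal.ofReal_mul hc).symm

/-- **CSCV-W ⇒ CSOV.** The cube form implies the occupation form with the same `σ₀, K⋆, τ₀, N₀` at accuracy `ε K⋆³`:
pathwise on the good set (which carries `localGibbsLaw`) `occ_i ≤ K⋆⁻³ cubHi_i` for every particle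
(`windowAvg_one_le_inv_mul_hi`; the peculiar velocity along a good orbit is measurable with integrable cube, `u_s` being
continuous for `s ∈ [0, t] ⊂ [0, T)`). [folklore] -/
theorem occupation_of_coherentW : CoherentSuprathermalContentVanishesW → CoherentSuprathermalOccupationVanishes := by
  intro h a₀ θ₀ u₀ ha hθ hu ha0 hθ0
  obtain ⟨σ₀, hσ₀, H⟩ := h a₀ θ₀ u₀ ha hθ hu ha0 hθ0
  refine ⟨σ₀, hσ₀, ?_⟩
  intro σ hσ hσlt T ρ θ u hE Φ htie t ht
  obtain ⟨K, hK, HK⟩ := H σ hσ hσlt T ρ θ u hE Φ htie t ht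
  refine ⟨K, hK, ?_⟩
  intro R hRm hR0 hR η hη ε hε
  obtain ⟨τ₀, hτ₀, Hτ⟩ := HK R hRm hR0 hR η hη (ε * K ^ 3) (by positivity)
  refine ⟨τ₀, hτ₀, fun τ hτ => ?_⟩
  obtain ⟨N₀, HN⟩ := Hτ τ hτ
  refine ⟨N₀, fun N hN s hs => ?_⟩
  have Hs := HN N hN s hs
  dsimp only at Hs ⊢
  have hw : 0 < τ * ((N : ℝ) + 1) ^ (-(1 / 3 : ℝ)) :=
    mul_pos (hτ₀.trans_le hτ) (Real.rpow_pos_of_pos (by positivity) _)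
  have hus : Continuous (u s) := (hE.smooth_velocity.isSmooth_slice ⟨hs.1, hs.2.trans_lt ht.2⟩).continuous
  refine (lintegral_ofReal_le_of_ae_le_const_mul (c := (K ^ 3)⁻¹) (by positivity) ?_ Hs).trans (le_of_eq ?_)
  · filter_upwards [ae_mem_good_localGibbsLaw σ a₀ u₀ θ₀ N (Φ N)] with z hz
    refine avg_ite_le_const_mul (by positivity) fun i => ?_
    exact windowAvg_one_le_inv_mul_hi hK hw.le (measurable_peculiar_orbit (Φ N) hz hus i)
      (intervalIntegrable_norm_peculiar_pow (Φ N) hz hus i 3 s _)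
  · congr 1
    field_simp

end Summit.AtomisticToContinuum.HydrodynamicLimit.Theorems.HydroLimitBandCoherenceOccupation

end
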